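/-
Copyright (c) 2026. All rights reserved.
Released under Apache 2.0 license as described in the file LICENSE.
-/
import Literature.AlgebraicGeometry.Pohlmann1968.DegenerateCMTypesAbelianFieldSporadicCycles
import Literature.AlgebraicGeometry.ComplexMultiplication.CMTorusInducedTypeHodgeClassesOfPower
import Literature.AlgebraicGeometry.ComplexMultiplication.InducedCMTypeNotSimple
import Literature.AlgebraicGeometry.Pohlmann1968.CMTypeRankInducedType
import Mathlib.FieldTheory.Galois.Abelian
import HarnessLib

/-!
# Lenstra's theorem (White 1993, Thm. 3 / Hazama 2003, Rem. 4.10) for NON-SIMPLE abelian varieties with complex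
# multiplication by an ABELIAN CM field: the Hodge ring of `A ≅ B^h` itself is generated by divisor classes iff the
# simple factor `B` is nondegenerate

Sequel of `Pohlmann1968/DegenerateCMTypesAbelianFieldSporadicCycles` (THEOREM 3 for a SIMPLE CM type) and of the
induced-type dictionary `ComplexMultiplication/CMTorusInducedTypeHodgeClassesOfPower` (Pohlmann's index sets of a
lifted type `Φ₁^K` against those of `Φ₁`).  THEOREMS ONLY (no definition, no named fact, no `sorry`).

## The print

S. P. White, *Sporadic cycles on CM abelian varieties*, Compositio Math. **88** (1993) 123–142
[White1993SporadicCycles], §1 (p. 123) conditions «(i) `dim(M_A) = d + 1`, (ii) The ring of Hodge cycles on `A` is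
generated by classes of divisors», THEOREM 3 (Lenstra) (p. 131): «Let `(K, S)` be any simple CM-type, where `K` is a
field with abelian Galois group. If `A` is any abelian variety of CM type `(K, S)` then `rank(M) = dim(A) + 1` if and
only if the ring of Hodge cycles on `A` is generated by classes of images of divisors.»  F. Hazama, *Hodge cycles on
abelian varieties with complex multiplication by cyclic CM-fields*, J. Math. Sci. Univ. Tokyo **10** (2003),
REMARK 4.10 (p. 595), drops «simple»: «It is shown by Lenstra that for any abelian variety `A` with complex
multiplication by an abelian CM-field, there always exists a nondivisorial Hodge cycle on `A` itself if `A` is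
degenerate (see [7])» ([7] = White 1993), with (p. 582) «When `dim Hg(A)` is smaller than `dim A`, the abelian
variety is degenerate in the sense that there is a nondivisorial Hodge cycle on some `Aᵏ`, `k ≥ 1`».

For a NON-simple `A` of CM type `(K; Φ)` — `Φ = Φ₁^K` induced from its primitive sub-pair `(K₁; Φ₁)` (Streng I.3.5,
tree `exists_primitive_inducedCMType_eq_of_isCMField`), `A ≅ B^{[K:K₁]}` with `B` simple of type `(K₁; Φ₁)` (Shimura
§6.2 Thm. 3) — White's condition (i) ALWAYS FAILS (`Rank(Φ₁^K) = Rank(Φ₁) ≤ dim B + 1 < dim A + 1`, tree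
`not_isNondegenerate_inducedCMType`), while (ii) holds e.g. for `E^h`, `E` a CM elliptic curve.  The statement of
Theorem 3 that survives for every CM type of an abelian CM field, and the precise content of Remark 4.10, is therefore:

  **(ii) for `A` ⟺ the simple factor `B` is nondegenerate (`Rank(Φ) = Rank(Φ₁) = dim B + 1`); otherwise `A`
  ITSELF carries an exceptional class** (and by Hazama's criterion for the simple `B`, tree
  `isNondegenerate_iff_forall_pow_hodgeClassSpan_eq`, the first condition is also «no power of `B` carries one»).

## What is proved

* §1 (realisation-free Lenstra) `AbelianCMField.exists_mem_pohlmannSets_not_mem_conjugate_of_not_isNondegenerate` —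
  for a DEGENERATE CM type `Φ` of an abelian CM field `K` and any `φ₀ : K → ℂ` there is a Galois-balanced `2m`-set of
  embeddings containing `φ₀` but not `φ̄₀` (White's «line» `Δ`); for `Φ` PRIMITIVE this is an index set of `Bᵐ ⊗ ℂ`
  outside those of `Dᵐ ⊗ ℂ`: `pohlmannSets_diff_nonempty_of_not_isNondegenerate`,
  `not_isNondegenerate_iff_exists_pohlmannSets_diff_nonempty`.
* §2 (the lifted type `Φ₁^K`, `K₁` abelian CM, `Φ₁` primitive, ANY number field `K ⊇ K₁`)
  `exists_pohlmannSets_inducedCMType_diff_nonempty_of_not_isNondegenerate` and the criterion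
  `not_isNondegenerate_iff_exists_pohlmannSets_inducedCMType_diff_nonempty` (index sets; the tree's slot transport
  `pohlmannSets_inducedCMType_diff_nonempty_of_diff_nonempty` keeps the codimension `m` of the class on `B`).
* §3 (realisations `IsCMTypeRealisation Φ A ι θ` of `Φ = Φ₁^K`, `K` a CM field — `A ≅ B^{[K:K₁]}`, NOT simple when
  `K₁ ≠ K`): **`exists_exceptional_of_not_isNondegenerate_inducedCMType`** (Rem. 4.10: `B` degenerate ⟹ a rational
  `(m,m)`-class on `A` itself outside `Dᵐ(A) ⊗ ℂ`), `forall_hodgeClassSpan_eq_of_isNondegenerate_inducedCMType`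
  (any CM field `K₁`: `B` nondegenerate ⟹ `Bᵐ(A) ⊗ ℂ = Dᵐ(A) ⊗ ℂ` for all `m`), and THEOREM 3 for `A ≅ B^h`:
  **`isNondegenerate_iff_forall_hodgeClassSpan_eq_inducedCMType`**,
  `cmTypeRank_eq_iff_forall_hodgeClassSpan_eq_inducedCMType` («`rank(M_A) = dim B + 1` iff …»),
  `not_isNondegenerate_iff_exists_exceptional_inducedCMType`, `exists_nonsimple_exceptional_inducedCMType` (existence
  of such NON-SIMPLE `A` over every CM field `K ⊋ K₁`).
* §4 (INTRINSIC: `K` an abelian CM field, `[IsAbelianGalois ℚ K]`, `Φ : CMType K` ARBITRARY, `A` any realisation)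
  **`forall_hodgeClassSpan_eq_iff_exists_isNondegenerate`** — `(∀ m, Bᵐ(A) ⊗ ℂ = Dᵐ(A) ⊗ ℂ) ⟺ ∃` sub-pair `(K₁; Φ₁)`
  inducing `Φ` with `Φ₁` nondegenerate (then `(K₁; Φ₁)` IS the primitive sub-pair, Kubota);
  `isNondegenerate_iff_forall_hodgeClassSpan_eq_of_primitive` / `cmTypeRank_eq_iff_forall_hodgeClassSpan_eq_of_primitive`
  (Thm. 3 read on the primitive sub-pair: «`rank(M_A) = dim B + 1` iff …»);
  `exists_exceptional_iff_forall_not_isNondegenerate`; **`exists_exceptional_of_primitive_not_isNondegenerate`**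
  (Rem. 4.10 with «degenerate» read on the simple factor); `forall_hodgeClassSpan_eq_or_exists_exceptional` (the
  dichotomy every such `A` obeys).

Honest scope: nothing is said about the algebraicity of these classes (that is the open question); White's Theorem 1
(`K` non-abelian: the equivalence fails) is not formalised; «degenerate» in Rem. 4.10 must be read on the simple
factor — with Hazama's literal `dim Hg(A) < dim A` the remark would be false for `B^h`, `B` nondegenerate, `h ≥ 2`.

## References

* [White1993SporadicCycles] S. P. White, Compositio Math. 88 (1993) 123–142 — §1 (i)/(ii), §4 Lemma 2, Lemma 3,
  Theorem 3 (Lenstra).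
* [Hazama2003CyclicCM] F. Hazama, J. Math. Sci. Univ. Tokyo 10 (2003) 581–598 — p. 582, Rem. 4.10 (p. 595).
* [Gordon1999HodgeAVSurvey] B. B. Gordon, *A survey of the Hodge conjecture for abelian varieties* — 9.2.2 ([B.138]),
  §9.3, Thm. 6.4 (Hazama).
* [Shimura1998] G. Shimura, *Abelian Varieties with Complex Multiplication and Modular Functions* — §6.2 Thm. 3
  (`A ≅ B^h` for an induced type), §8.2 Prop. 26, §32.9 (`r(ξ) = r(Inf ξ)`).
* [Streng2010] M. Streng, *Complex multiplication of abelian surfaces* — Ch. I Def. 3.2, Lemma 3.5.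
* [Pohlmann1968] H. Pohlmann, Ann. of Math. 88 (1968) — Thm. 1 and §3.
* [Kubota1965] T. Kubota, Trans. AMS 118 (1965) — §2 (nondegenerate ⟹ primitive).

## Provenance

Cell `pub-hodgecm2` (COR-CM), literature seat `lit-deligne-3` gen 20 (claim IMPRIMITIVE-ABELIAN; count-neutral).
Consumes BY NAME g19's `AbelianCMField.exists_sporadic_galType_of_not_isNondegenerate` /
`exists_pohlmannSet_of_sporadic_galType`, lit-hodgefound's `pohlmannSets_inducedCMType_diff_nonempty_of_diff_nonempty` /
`IsNondegenerate.pohlmannSets_inducedCMType_subset`, the tree's `exists_exceptional_iff`,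
`pohlmannDivisorSets_eq_of_primitive`, `cmTypeRank_inducedCMType`, `not_isSimple_of_isCMTypeRealisation_inducedCMType`,
`exists_primitive_inducedCMType_eq_of_isCMField`, and Mathlib's `IsAbelianGalois`.
-/

set_option autoImplicit false

noncomputable section

open scoped BigOperators NumberField IsMulCommutative Classical
open CategoryTheory NumberField Module

namespace Literature.AlgebraicGeometry.Pohlmann1968

namespace AbelianCMField

open Literature.NumberTheory.ComplexMultiplication
open Literature.AlgebraicGeometry.Motives (AbelianVariety CMType)
open Literature.AlgebraicGeometry.HodgeTheory
open Literature.AlgebraicGeometry.VanGeemen1994 (hodgeClassSpan)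
open Literature.AlgebraicGeometry.ComplexMultiplication (IsCMTypeRealisation isSimple_iff_isPrimitive
  exists_isCMTypeRealisation isPrimitive_ringEquiv_complex_iff not_isSimple_of_isCMTypeRealisation_inducedCMType)
open Literature.Barriers.HodgeConjecture (divisorClassesSpan)

/-! ## §1 Lenstra's theorem, realisation-free: an index set of `Bᵐ ⊗ ℂ` outside those of `Dᵐ ⊗ ℂ` -/

section IndexSets

variable {K : Type} [Field K] [NumberField K] [Normal ℚ K] [IsMulCommutative (K ≃ₐ[ℚ] K)] [IsCMField K]

/-- **Lenstra, on the embeddings** (White's proof of Thm. 3: «there exists an element in `N` whose coefficients are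
`0, ±1` … which gives us a "line" `Δ`»): if `K/ℚ` is ABELIAN and `Φ` is DEGENERATE, then for every `φ₀ : K → ℂ` some
Galois-balanced `2m`-subset `Δ ⊆ Hom(K, ℂ)` contains `φ₀` but not `φ̄₀`.  No primitivity is needed here.
[cite: White1993SporadicCycles, §4 Lemma 3 and Theorem 3 (proof)] [cite: Kubota1965, §4 Lemma 2] -/
theorem exists_mem_pohlmannSets_not_mem_conjugate_of_not_isNondegenerate (Φ : CMType K)
    (hdeg : ¬ IsNondegenerate Φ) (φ₀ : K →+* ℂ) :
    ∃ m : ℕ, ∃ Δ ∈ pohlmannSets Φ m, φ₀ ∈ Δ ∧ ComplexEmbedding.conjugate φ₀ ∉ Δ := by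
  set ρ : K ≃ₐ[ℚ] K := (IsCMField.complexConj K).restrictScalars ℚ with hρdef
  have hρ : ∀ x, φ₀ (ρ x) = starRingEnd ℂ (φ₀ x) := fun x => by
    rw [hρdef, AlgEquiv.restrictScalars_apply]
    exact IsCMField.complexEmbedding_complexConj K φ₀ x
  obtain ⟨ΔG, hbal, h1, hsp⟩ := exists_sporadic_galType_of_not_isNondegenerate hρ Φ hdeg
  exact exists_pohlmannSet_of_sporadic_galType hρ Φ hbal h1 hsp

/-- **For a PRIMITIVE degenerate type of an abelian CM field, some Pohlmann set is not a Pohlmann divisor set**: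
`(pohlmannSets Φ m ∖ pohlmannDivisorSets Φ m) ≠ ∅` for some `m` — the index-set form of «(i) fails ⟹ (ii) fails»
(for a primitive type the divisor index sets are the balanced sets closed under conjugation, tree
`pohlmannDivisorSets_eq_of_primitive`). [cite: White1993SporadicCycles, §4 Theorem 3] [cite: Gordon1999HodgeAVSurvey, 9.2.2] -/
theorem pohlmannSets_diff_nonempty_of_not_isNondegenerate {Φ : CMType K}
    (hsep : ∀ s t : K →+* ℂ,
      (∀ τ : ℂ ≃+* ℂ, ((τ : ℂ →+* ℂ).comp s ∈ Φ.1 ↔ (τ : ℂ →+* ℂ).comp t ∈ Φ.1)) → s = t)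
    (hdeg : ¬ IsNondegenerate Φ) :
    ∃ m : ℕ, (pohlmannSets Φ m \ pohlmannDivisorSets Φ m).Nonempty := by
  obtain ⟨φ₀⟩ : Nonempty (K →+* ℂ) := inferInstance
  obtain ⟨m, Δ, hΔ, hφ₀, hφ₀'⟩ := exists_mem_pohlmannSets_not_mem_conjugate_of_not_isNondegenerate Φ hdeg φ₀
  refine ⟨m, Δ, hΔ, fun hD => hφ₀' ?_⟩
  rw [pohlmannDivisorSets_eq_of_primitive hsep m] at hD
  exact hD.2 φ₀ hφ₀

/-- **Index-set criterion for a primitive type of an abelian CM field**: `Φ` is degenerate iff some balanced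
`2m`-set is not a disjoint union of balanced pairs (⟸ for every CM field: tree `IsNondegenerate.pohlmannSets_subset`).
[cite: White1993SporadicCycles, §4 Theorem 3] [cite: Gordon1999HodgeAVSurvey, 9.2.2 and §9.3] -/
theorem not_isNondegenerate_iff_exists_pohlmannSets_diff_nonempty {Φ : CMType K}
    (hsep : ∀ s t : K →+* ℂ,
      (∀ τ : ℂ ≃+* ℂ, ((τ : ℂ →+* ℂ).comp s ∈ Φ.1 ↔ (τ : ℂ →+* ℂ).comp t ∈ Φ.1)) → s = t) :
    ¬ IsNondegenerate Φ ↔ ∃ m : ℕ, (pohlmannSets Φ m \ pohlmannDivisorSets Φ m).Nonempty := by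
  refine ⟨pohlmannSets_diff_nonempty_of_not_isNondegenerate hsep, ?_⟩
  rintro ⟨m, Δ, hΔ, hΔ'⟩ hΦ
  exact hΔ' (hΦ.pohlmannSets_subset m hΔ)

end IndexSets

/-! ## §2 The lifted type `Φ₁^K` of a primitive degenerate `Φ₁` over an abelian CM field `K₁` -/

section Induced

variable {K : Type} [Field K] [NumberField K] {K₁ : Type} [Field K₁] [NumberField K₁] [Normal ℚ K₁]
  [IsMulCommutative (K₁ ≃ₐ[ℚ] K₁)] [IsCMField K₁] [Algebra K₁ K] {Φ₁ : CMType K₁}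

/-- **Degenerate simple factor ⟹ an exceptional index set of the LIFTED type, same codimension**: for `K₁/ℚ`
abelian, `Φ₁` primitive and degenerate, and ANY number field `K ⊇ K₁`, some balanced `2m`-subset of `Hom(K, ℂ)` for
`Φ₁^K` is not a disjoint union of balanced pairs (a sporadic set of `Φ₁` placed in one slot of
`Hom(K, ℂ) ≃ ⊔_{i<[K:K₁]} Hom(K₁, ℂ)` — the pull-back along a projection `B^h → B`).
[cite: White1993SporadicCycles, §4 Theorem 3] [cite: Shimura1998, §6.2 Thm. 3] [cite: Gordon1999HodgeAVSurvey, §9.2] -/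
theorem exists_pohlmannSets_inducedCMType_diff_nonempty_of_not_isNondegenerate
    (hsep : ∀ s t : K₁ →+* ℂ,
      (∀ τ : ℂ ≃+* ℂ, ((τ : ℂ →+* ℂ).comp s ∈ Φ₁.1 ↔ (τ : ℂ →+* ℂ).comp t ∈ Φ₁.1)) → s = t)
    (hdeg : ¬ IsNondegenerate Φ₁) :
    ∃ m : ℕ, (pohlmannSets (inducedCMType (algebraMap K₁ K) Φ₁) m \
      pohlmannDivisorSets (inducedCMType (algebraMap K₁ K) Φ₁) m).Nonempty := by
  obtain ⟨m, hm⟩ := pohlmannSets_diff_nonempty_of_not_isNondegenerate hsep hdeg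
  exact ⟨m, pohlmannSets_inducedCMType_diff_nonempty_of_diff_nonempty Φ₁ hm⟩

/-- **Index-set criterion for the lifted type**: for `K₁/ℚ` abelian and `Φ₁` primitive, `Φ₁` is degenerate iff
for some `m` a balanced `2m`-set of `Φ₁^K` is not a disjoint union of balanced pairs — for EVERY number field
`K ⊇ K₁` (the tree's Hazama converse for induced types needed an extension of prescribed degree; for abelian `K₁`
none is needed). [cite: White1993SporadicCycles, §4 Theorem 3] [cite: Gordon1999HodgeAVSurvey, Thm. 6.4 and §9.3] -/
theorem not_isNondegenerate_iff_exists_pohlmannSets_inducedCMType_diff_nonempty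
    (hsep : ∀ s t : K₁ →+* ℂ,
      (∀ τ : ℂ ≃+* ℂ, ((τ : ℂ →+* ℂ).comp s ∈ Φ₁.1 ↔ (τ : ℂ →+* ℂ).comp t ∈ Φ₁.1)) → s = t) :
    ¬ IsNondegenerate Φ₁ ↔ ∃ m : ℕ, (pohlmannSets (inducedCMType (algebraMap K₁ K) Φ₁) m \
      pohlmannDivisorSets (inducedCMType (algebraMap K₁ K) Φ₁) m).Nonempty := by
  refine ⟨exists_pohlmannSets_inducedCMType_diff_nonempty_of_not_isNondegenerate hsep, ?_⟩
  rintro ⟨m, hm⟩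
  exact not_isNondegenerate_of_pohlmannSets_inducedCMType_diff_nonempty hm

end Induced

/-! ## §3 The abelian varieties `A ≅ B^h` of type `Φ₁^K`: a nondivisorial Hodge cycle on `A` itself -/

section Realisations

variable {K : Type} [Field K] [NumberField K] [IsCMField K] {K₁ : Type} [Field K₁] [NumberField K₁]
  [IsCMField K₁] [Algebra K₁ K] {Φ₁ : CMType K₁} {Φ : CMType K}
  {A : AbelianVariety ℂ} {ι : 𝓞 K →+* End A} {θ : K →+* Module.End ℂ (complexBetti A.X 1)}

/-- **`B` nondegenerate ⟹ the Hodge ring of `A ≅ B^h` is generated by divisor classes** (any CM fields `K₁ ⊆ K`):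
for every realisation `(A, ι, θ)` of the lifted type `Φ₁^K` and every `m`, `Bᵐ(A) ⊗ ℂ = Dᵐ(A) ⊗ ℂ` — White's
observation «the criterion of Pohlmann immediately shows that (i) implies (ii)» for the simple factor, through the
tree's `IsNondegenerate.pohlmannSets_inducedCMType_subset` and Pohlmann's criterion `exists_exceptional_iff`.
[cite: White1993SporadicCycles, §1] [cite: Gordon1999HodgeAVSurvey, §9.3 and Thm. 6.4] [cite: Pohlmann1968, Thm. 1] -/
theorem forall_hodgeClassSpan_eq_of_isNondegenerate_inducedCMType (hΦ : inducedCMType (algebraMap K₁ K) Φ₁ = Φ)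
    (hΦ₁ : IsNondegenerate Φ₁) (hA : IsCMTypeRealisation Φ A ι θ) (m : ℕ) :
    hodgeClassSpan (finrank ℚ K / 2) A.X m = divisorClassesSpan A.X (finrank ℚ K / 2) m := by
  refine le_antisymm ?_ (divisorClassesSpan_le_hodgeClassSpan hA m)
  rw [divisorClassesSpan_eq_iSup_cmEigenclasses hA m, (Pohlmann1968_thm1_holds K Φ A ι θ hA m).1]
  subst hΦ
  exact iSup₂_le fun Δ hΔ => le_iSup₂_of_le Δ (hΦ₁.pohlmannSets_inducedCMType_subset m hΔ) le_rfl

/-- … hence no exceptional Hodge class (rational `(m,m)`-class outside `Dᵐ(A) ⊗ ℂ`) on `A`.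
[cite: Gordon1999HodgeAVSurvey, §9.3] -/
theorem not_exists_exceptional_of_isNondegenerate_inducedCMType (hΦ : inducedCMType (algebraMap K₁ K) Φ₁ = Φ)
    (hΦ₁ : IsNondegenerate Φ₁) (hA : IsCMTypeRealisation Φ A ι θ) (m : ℕ) :
    ¬ ∃ c : complexBetti A.X (2 * m), IsRationalClass c ∧
        IsOfHodgeType (finrank ℚ K / 2) A.X (2 * m) m m c ∧ c ∉ divisorClassesSpan A.X (finrank ℚ K / 2) m := by
  rintro ⟨c, hcQ, hcH, hcD⟩
  exact hcD ((forall_hodgeClassSpan_eq_of_isNondegenerate_inducedCMType hΦ hΦ₁ hA m) ▸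
    Submodule.subset_span ⟨hcQ, hcH⟩)

variable [Normal ℚ K₁] [IsMulCommutative (K₁ ≃ₐ[ℚ] K₁)]

/-- **REMARK 4.10 (Lenstra) for `A ≅ B^h`: a nondivisorial Hodge cycle on `A` ITSELF.**  Let `K₁ ⊆ K` be CM fields
with `K₁/ℚ` ABELIAN, `Φ₁` a PRIMITIVE and DEGENERATE CM type of `K₁`, and `(A, ι, θ)` any abelian variety of the
lifted type `(K; Φ₁^K)` (so `A` is isogenous to `B^{[K:K₁]}`, `B` simple of type `(K₁; Φ₁)`; `A` is NOT simple when
`K₁ ≠ K`).  Then for some `m`, `A` carries a rational `(m,m)`-class outside `Dᵐ(A) ⊗ ℂ`.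
[cite: Hazama2003CyclicCM, Rem. 4.10] [cite: White1993SporadicCycles, §4 Theorem 3] [cite: Pohlmann1968, Thm. 1 and §3]
[cite: Shimura1998, §6.2 Thm. 3] -/
theorem exists_exceptional_of_not_isNondegenerate_inducedCMType (hΦ : inducedCMType (algebraMap K₁ K) Φ₁ = Φ)
    (hsep : ∀ s t : K₁ →+* ℂ,
      (∀ τ : ℂ ≃+* ℂ, ((τ : ℂ →+* ℂ).comp s ∈ Φ₁.1 ↔ (τ : ℂ →+* ℂ).comp t ∈ Φ₁.1)) → s = t)
    (hdeg : ¬ IsNondegenerate Φ₁) (hA : IsCMTypeRealisation Φ A ι θ) :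
    ∃ m : ℕ, ∃ c : complexBetti A.X (2 * m), IsRationalClass c ∧
      IsOfHodgeType (finrank ℚ K / 2) A.X (2 * m) m m c ∧ c ∉ divisorClassesSpan A.X (finrank ℚ K / 2) m := by
  obtain ⟨m, hm⟩ := exists_pohlmannSets_inducedCMType_diff_nonempty_of_not_isNondegenerate (K := K) hsep hdeg
  subst hΦ
  exact ⟨m, (exists_exceptional_iff hA m).2 hm⟩

/-- The same with primitivity as `IsPrimitive` (Shimura §8.2 Prop. 26, «simple CM-type» — `B` simple).
[cite: Hazama2003CyclicCM, Rem. 4.10] [cite: Shimura1998, §8.2 Prop. 26] -/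
theorem exists_exceptional_of_not_isNondegenerate_inducedCMType_of_isPrimitive
    (hΦ : inducedCMType (algebraMap K₁ K) Φ₁ = Φ) {s₀ : K₁ →+* ℂ} (hprim : IsPrimitive (ℂ ≃+* ℂ) Φ₁.1 s₀)
    (hdeg : ¬ IsNondegenerate Φ₁) (hA : IsCMTypeRealisation Φ A ι θ) :
    ∃ m : ℕ, ∃ c : complexBetti A.X (2 * m), IsRationalClass c ∧
      IsOfHodgeType (finrank ℚ K / 2) A.X (2 * m) m m c ∧ c ∉ divisorClassesSpan A.X (finrank ℚ K / 2) m :=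
  exists_exceptional_of_not_isNondegenerate_inducedCMType hΦ ((isPrimitive_ringEquiv_complex_iff Φ₁ s₀).1 hprim)
    hdeg hA

/-- **THEOREM 3 (Lenstra) for `A ≅ B^h`**: for `K₁/ℚ` abelian, `Φ₁` primitive and ANY realisation `(A, ι, θ)` of the
lifted type `(K; Φ₁^K)` over a CM field `K ⊇ K₁`: the simple factor is nondegenerate iff the Hodge ring of `A` ITSELF
is generated by divisor classes, `IsNondegenerate Φ₁ ↔ ∀ m, Bᵐ(A) ⊗ ℂ = Dᵐ(A) ⊗ ℂ`.
[cite: White1993SporadicCycles, §4 Theorem 3] [cite: Hazama2003CyclicCM, Rem. 4.10] [cite: Gordon1999HodgeAVSurvey, Thm. 6.4] -/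
theorem isNondegenerate_iff_forall_hodgeClassSpan_eq_inducedCMType (hΦ : inducedCMType (algebraMap K₁ K) Φ₁ = Φ)
    (hsep : ∀ s t : K₁ →+* ℂ,
      (∀ τ : ℂ ≃+* ℂ, ((τ : ℂ →+* ℂ).comp s ∈ Φ₁.1 ↔ (τ : ℂ →+* ℂ).comp t ∈ Φ₁.1)) → s = t)
    (hA : IsCMTypeRealisation Φ A ι θ) :
    IsNondegenerate Φ₁ ↔
      ∀ m : ℕ, hodgeClassSpan (finrank ℚ K / 2) A.X m = divisorClassesSpan A.X (finrank ℚ K / 2) m := by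
  refine ⟨fun hΦ₁ m => forall_hodgeClassSpan_eq_of_isNondegenerate_inducedCMType hΦ hΦ₁ hA m, fun h => ?_⟩
  by_contra hdeg
  obtain ⟨m, c, hcQ, hcH, hcD⟩ := exists_exceptional_of_not_isNondegenerate_inducedCMType hΦ hsep hdeg hA
  exact hcD ((h m) ▸ Submodule.subset_span ⟨hcQ, hcH⟩)

/-- **«`rank(M) = dim(B) + 1` if and only if the ring of Hodge cycles on `A` is generated by classes of images of
divisors»** — Theorem 3 for `A ≅ B^h` with the rank read on `A`'s own type: `Rank(Φ₁^K) = Rank(Φ₁)` (Shimura §32.9,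
tree `cmTypeRank_inducedCMType`) and `dim B = [K₁:ℚ]/2`. [cite: White1993SporadicCycles, §4 Theorem 3]
[cite: Shimura1998, §32.9] -/
theorem cmTypeRank_eq_iff_forall_hodgeClassSpan_eq_inducedCMType (hΦ : inducedCMType (algebraMap K₁ K) Φ₁ = Φ)
    (hsep : ∀ s t : K₁ →+* ℂ,
      (∀ τ : ℂ ≃+* ℂ, ((τ : ℂ →+* ℂ).comp s ∈ Φ₁.1 ↔ (τ : ℂ →+* ℂ).comp t ∈ Φ₁.1)) → s = t)
    (hA : IsCMTypeRealisation Φ A ι θ) :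
    cmTypeRank Φ = finrank ℚ K₁ / 2 + 1 ↔
      ∀ m : ℕ, hodgeClassSpan (finrank ℚ K / 2) A.X m = divisorClassesSpan A.X (finrank ℚ K / 2) m := by
  rw [← isNondegenerate_iff_forall_hodgeClassSpan_eq_inducedCMType hΦ hsep hA, isNondegenerate_iff, ← hΦ,
    cmTypeRank_inducedCMType]

/-- **(ii) fails iff the simple factor is degenerate**: `¬ IsNondegenerate Φ₁ ↔ A` itself carries a rational
`(m,m)`-class outside `Dᵐ(A) ⊗ ℂ` for some `m`. [cite: White1993SporadicCycles, §1 (i)–(ii) and §4 Theorem 3]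
[cite: Hazama2003CyclicCM, Rem. 4.10] -/
theorem not_isNondegenerate_iff_exists_exceptional_inducedCMType (hΦ : inducedCMType (algebraMap K₁ K) Φ₁ = Φ)
    (hsep : ∀ s t : K₁ →+* ℂ,
      (∀ τ : ℂ ≃+* ℂ, ((τ : ℂ →+* ℂ).comp s ∈ Φ₁.1 ↔ (τ : ℂ →+* ℂ).comp t ∈ Φ₁.1)) → s = t)
    (hA : IsCMTypeRealisation Φ A ι θ) :
    ¬ IsNondegenerate Φ₁ ↔ ∃ m : ℕ, ∃ c : complexBetti A.X (2 * m), IsRationalClass c ∧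
      IsOfHodgeType (finrank ℚ K / 2) A.X (2 * m) m m c ∧ c ∉ divisorClassesSpan A.X (finrank ℚ K / 2) m := by
  refine ⟨fun hdeg => exists_exceptional_of_not_isNondegenerate_inducedCMType hΦ hsep hdeg hA, ?_⟩
  rintro ⟨m, hm⟩ hΦ₁
  exact not_exists_exceptional_of_isNondegenerate_inducedCMType hΦ hΦ₁ hA m hm

omit [IsCMField K] [IsCMField K₁] [Normal ℚ K₁] [IsMulCommutative (K₁ ≃ₐ[ℚ] K₁)] in
/-- The realisations of a lifted type `Φ₁^K` with `[K₁ : ℚ] < [K : ℚ]` are NOT simple (Shimura §6.2 Thm. 3: `A ≅ B^h`,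
`h ≥ 2`; tree `not_isSimple_of_isCMTypeRealisation_inducedCMType`). [cite: Shimura1998, §6.2 Thm. 3 and §8.2 Prop. 26] -/
theorem not_isSimple_of_inducedCMType (hΦ : inducedCMType (algebraMap K₁ K) Φ₁ = Φ)
    (hlt : finrank ℚ K₁ < finrank ℚ K) (hA : IsCMTypeRealisation Φ A ι θ) : ¬ A.IsSimple := by
  subst hΦ
  exact not_isSimple_of_isCMTypeRealisation_inducedCMType (algebraMap K₁ K) Φ₁ hA hlt

/-- **Existence of NON-SIMPLE degenerate examples over every CM extension**: for `K₁/ℚ` abelian, `Φ₁` primitive and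
degenerate, and any CM field `K ⊇ K₁` with `[K₁:ℚ] < [K:ℚ]`, there is an abelian variety of type `(K; Φ₁^K)` (Shimura
§6.2 Thm. 3 existence, tree `exists_isCMTypeRealisation`) which is NOT simple and carries a rational `(m,m)`-class
outside `Dᵐ ⊗ ℂ` for some `m`. [cite: Hazama2003CyclicCM, Rem. 4.10] [cite: Shimura1998, §6.2 Thm. 3] -/
theorem exists_nonsimple_exceptional_inducedCMType
    (hsep : ∀ s t : K₁ →+* ℂ,
      (∀ τ : ℂ ≃+* ℂ, ((τ : ℂ →+* ℂ).comp s ∈ Φ₁.1 ↔ (τ : ℂ →+* ℂ).comp t ∈ Φ₁.1)) → s = t)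
    (hdeg : ¬ IsNondegenerate Φ₁) (hlt : finrank ℚ K₁ < finrank ℚ K) :
    ∃ (A : AbelianVariety ℂ) (ι : 𝓞 K →+* End A) (θ : K →+* Module.End ℂ (complexBetti A.X 1)),
      IsCMTypeRealisation (inducedCMType (algebraMap K₁ K) Φ₁) A ι θ ∧ ¬ A.IsSimple ∧
        A.dim = finrank ℚ K / 2 ∧
        ∃ m : ℕ, ∃ c : complexBetti A.X (2 * m), IsRationalClass c ∧
          IsOfHodgeType (finrank ℚ K / 2) A.X (2 * m) m m c ∧ c ∉ divisorClassesSpan A.X (finrank ℚ K / 2) m := by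
  obtain ⟨A, ι, θ, hA⟩ := exists_isCMTypeRealisation (inducedCMType (algebraMap K₁ K) Φ₁)
  exact ⟨A, ι, θ, hA, not_isSimple_of_inducedCMType rfl hlt hA, Motives.schemeDim_eq_holds hA.1,
    exists_exceptional_of_not_isNondegenerate_inducedCMType rfl hsep hdeg hA⟩

end Realisations

/-! ## §4 Intrinsic form: an ARBITRARY CM type of an abelian CM field -/

section Intrinsic

variable {K : Type} [Field K] [NumberField K] [IsAbelianGalois ℚ K] [IsCMField K] {Φ : CMType K}
  {A : AbelianVariety ℂ} {ι : 𝓞 K →+* End A} {θ : K →+* Module.End ℂ (complexBetti A.X 1)}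

omit [IsCMField K] in
/-- Instance hygiene.  A subfield `K₁` of an abelian number field `K` is Galois over `ℚ` with commutative group
(Mathlib: `IsAbelianGalois ℚ K₁` for `K₁ : IntermediateField ℚ K`), but Mathlib states this for the `ℚ`-algebra
structure of `↥K₁` restricted from `K`, whereas the hypotheses `[Normal ℚ K₁] [IsMulCommutative (K₁ ≃ₐ[ℚ] K₁)]` of
§§1–3 are synthesised with whatever `Algebra ℚ ↥K₁` instance search returns (`DivisionRing.toRatAlgebra`); the two
structures need not be reducibly equal; so we prove the two facts for ANY `inst`, by `IsAbelianGalois.tower_bot` along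
the tower `ℚ ⊆ K₁ ⊆ K` (a scalar tower for every `ℚ`-structure, `map_ratCast`). [folklore] -/
private theorem normal_and_isMulCommutative_intermediateField (K₁ : IntermediateField ℚ K)
    (inst : Algebra ℚ K₁) :
    @Normal ℚ K₁ _ _ inst ∧ @IsMulCommutative (@AlgEquiv ℚ K₁ K₁ _ _ _ inst inst) _ := by
  letI : Algebra ℚ K₁ := inst
  -- `ℚ ⊆ K₁ ⊆ K` is a scalar tower for `inst` (both composites are the rational cast), stated against the
  -- expected type of `tower_bot` so that no second `SMul ℚ ↥K₁` instance enters
  have hab : IsAbelianGalois ℚ K₁ :=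
    @IsAbelianGalois.tower_bot ℚ K₁ K _ _ _ _ _ _
      (IsScalarTower.of_algebraMap_eq fun q =>
        ((eq_ratCast (algebraMap ℚ K) q).trans (map_ratCast (algebraMap K₁ K) q).symm).trans
          (congrArg (algebraMap K₁ K) (eq_ratCast (algebraMap ℚ K₁) q).symm)) _
  exact ⟨hab.toIsGalois.to_normal, hab.toIsMulCommutative⟩

/-- **REMARK 4.10 with «degenerate» read on the simple factor**: let `K` be an ABELIAN CM field, `Φ` ANY CM type of
`K`, `(K₁; Φ₁)` a primitive sub-pair inducing `Φ` (it exists and is unique, Streng I.3.5) with `Φ₁` DEGENERATE.  Then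
every abelian variety `A` of type `(K; Φ)` carries, for some `m`, a rational `(m,m)`-class outside `Dᵐ(A) ⊗ ℂ`.
(`K₁ ⊆ K` inherits an abelian Galois group: Mathlib `IsAbelianGalois` on intermediate fields.)
[cite: Hazama2003CyclicCM, Rem. 4.10] [cite: White1993SporadicCycles, §4 Theorem 3] [cite: Streng2010, Ch. I Lemma 3.5] -/
theorem exists_exceptional_of_primitive_not_isNondegenerate {K₁ : IntermediateField ℚ K} {Φ₁ : CMType K₁}
    (hΦ : inducedCMType (algebraMap K₁ K) Φ₁ = Φ)
    (hsep : ∀ s t : K₁ →+* ℂ,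
      (∀ τ : ℂ ≃+* ℂ, ((τ : ℂ →+* ℂ).comp s ∈ Φ₁.1 ↔ (τ : ℂ →+* ℂ).comp t ∈ Φ₁.1)) → s = t)
    (hdeg : ¬ IsNondegenerate Φ₁) (hA : IsCMTypeRealisation Φ A ι θ) :
    ∃ m : ℕ, ∃ c : complexBetti A.X (2 * m), IsRationalClass c ∧
      IsOfHodgeType (finrank ℚ K / 2) A.X (2 * m) m m c ∧ c ∉ divisorClassesSpan A.X (finrank ℚ K / 2) m := by
  haveI : IsCMField K₁ := isCMField_of_cmType_intermediateField K₁ Φ₁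
  obtain ⟨hN, hC⟩ := normal_and_isMulCommutative_intermediateField (K := K) K₁ inferInstance
  haveI := hN
  haveI := hC
  exact exists_exceptional_of_not_isNondegenerate_inducedCMType hΦ hsep hdeg hA

/-- **THEOREM 3 read on the primitive sub-pair** of an arbitrary CM type `Φ` of an abelian CM field `K`: for
`(K₁; Φ₁)` primitive inducing `Φ` and any realisation `A` of `(K; Φ)`, `IsNondegenerate Φ₁ ↔ ∀ m, Bᵐ(A) ⊗ ℂ = Dᵐ(A) ⊗ ℂ`.
[cite: White1993SporadicCycles, §4 Theorem 3] [cite: Hazama2003CyclicCM, Rem. 4.10] [cite: Streng2010, Ch. I Lemma 3.5] -/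
theorem isNondegenerate_iff_forall_hodgeClassSpan_eq_of_primitive {K₁ : IntermediateField ℚ K} {Φ₁ : CMType K₁}
    (hΦ : inducedCMType (algebraMap K₁ K) Φ₁ = Φ)
    (hsep : ∀ s t : K₁ →+* ℂ,
      (∀ τ : ℂ ≃+* ℂ, ((τ : ℂ →+* ℂ).comp s ∈ Φ₁.1 ↔ (τ : ℂ →+* ℂ).comp t ∈ Φ₁.1)) → s = t)
    (hA : IsCMTypeRealisation Φ A ι θ) :
    IsNondegenerate Φ₁ ↔
      ∀ m : ℕ, hodgeClassSpan (finrank ℚ K / 2) A.X m = divisorClassesSpan A.X (finrank ℚ K / 2) m := by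
  haveI : IsCMField K₁ := isCMField_of_cmType_intermediateField K₁ Φ₁
  obtain ⟨hN, hC⟩ := normal_and_isMulCommutative_intermediateField (K := K) K₁ inferInstance
  haveI := hN
  haveI := hC
  exact isNondegenerate_iff_forall_hodgeClassSpan_eq_inducedCMType hΦ hsep hA

/-- **«`rank(M_A) = dim B + 1` iff the Hodge ring of `A` is generated by divisor classes»**, for an arbitrary CM type
`Φ` of an abelian CM field read against its primitive sub-pair `(K₁; Φ₁)` (`dim B = [K₁:ℚ]/2`, `Rank(Φ) = Rank(Φ₁)`).
[cite: White1993SporadicCycles, §4 Theorem 3] [cite: Shimura1998, §32.9] -/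
theorem cmTypeRank_eq_iff_forall_hodgeClassSpan_eq_of_primitive {K₁ : IntermediateField ℚ K} {Φ₁ : CMType K₁}
    (hΦ : inducedCMType (algebraMap K₁ K) Φ₁ = Φ)
    (hsep : ∀ s t : K₁ →+* ℂ,
      (∀ τ : ℂ ≃+* ℂ, ((τ : ℂ →+* ℂ).comp s ∈ Φ₁.1 ↔ (τ : ℂ →+* ℂ).comp t ∈ Φ₁.1)) → s = t)
    (hA : IsCMTypeRealisation Φ A ι θ) :
    cmTypeRank Φ = finrank ℚ K₁ / 2 + 1 ↔
      ∀ m : ℕ, hodgeClassSpan (finrank ℚ K / 2) A.X m = divisorClassesSpan A.X (finrank ℚ K / 2) m := by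
  haveI : IsCMField K₁ := isCMField_of_cmType_intermediateField K₁ Φ₁
  obtain ⟨hN, hC⟩ := normal_and_isMulCommutative_intermediateField (K := K) K₁ inferInstance
  haveI := hN
  haveI := hC
  exact cmTypeRank_eq_iff_forall_hodgeClassSpan_eq_inducedCMType hΦ hsep hA

/-- **THEOREM 3 for EVERY CM type of an abelian CM field.**  For `K` an abelian CM field, `Φ` ANY CM type of `K` and
`(A, ι, θ)` any abelian variety of type `(K; Φ)`: the Hodge ring of `A` is generated by divisor classes
(`Bᵐ(A) ⊗ ℂ = Dᵐ(A) ⊗ ℂ` for all `m`) iff `Φ` is induced from a NONDEGENERATE type `Φ₁` of a subfield `K₁` — which is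
then primitive (Kubota) and hence THE primitive sub-pair of `Φ`, i.e. iff the simple factor of `A` is nondegenerate.
[cite: White1993SporadicCycles, §4 Theorem 3] [cite: Hazama2003CyclicCM, Rem. 4.10] [cite: Kubota1965, §2]
[cite: Streng2010, Ch. I Lemma 3.5] -/
theorem forall_hodgeClassSpan_eq_iff_exists_isNondegenerate (hA : IsCMTypeRealisation Φ A ι θ) :
    (∀ m : ℕ, hodgeClassSpan (finrank ℚ K / 2) A.X m = divisorClassesSpan A.X (finrank ℚ K / 2) m) ↔
      ∃ (K₁ : IntermediateField ℚ K) (Φ₁ : CMType K₁),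
        inducedCMType (algebraMap K₁ K) Φ₁ = Φ ∧ IsNondegenerate Φ₁ := by
  constructor
  · intro h
    obtain ⟨K₁, Φ₁, hK₁, hΦ, hsep, -⟩ := exists_primitive_inducedCMType_eq_of_isCMField Φ
    haveI := hK₁
    obtain ⟨hN, hC⟩ := normal_and_isMulCommutative_intermediateField (K := K) K₁ inferInstance
    haveI := hN
    haveI := hC
    exact ⟨K₁, Φ₁, hΦ, (isNondegenerate_iff_forall_hodgeClassSpan_eq_inducedCMType hΦ hsep hA).2 h⟩
  · rintro ⟨K₁, Φ₁, hΦ, hΦ₁⟩ m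
    haveI : IsCMField K₁ := isCMField_of_cmType_intermediateField K₁ Φ₁
    exact forall_hodgeClassSpan_eq_of_isNondegenerate_inducedCMType hΦ hΦ₁ hA m

/-- **`A` itself carries an exceptional Hodge class iff every sub-pair inducing its type is degenerate** (equivalently:
iff the primitive sub-pair is) — `K` an abelian CM field, `Φ` arbitrary. [cite: Hazama2003CyclicCM, Rem. 4.10]
[cite: White1993SporadicCycles, §1 (i)–(ii) and §4 Theorem 3] -/
theorem exists_exceptional_iff_forall_not_isNondegenerate (hA : IsCMTypeRealisation Φ A ι θ) :
    (∃ m : ℕ, ∃ c : complexBetti A.X (2 * m), IsRationalClass c ∧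
        IsOfHodgeType (finrank ℚ K / 2) A.X (2 * m) m m c ∧ c ∉ divisorClassesSpan A.X (finrank ℚ K / 2) m) ↔
      ∀ (K₁ : IntermediateField ℚ K) (Φ₁ : CMType K₁),
        inducedCMType (algebraMap K₁ K) Φ₁ = Φ → ¬ IsNondegenerate Φ₁ := by
  constructor
  · rintro ⟨m, hm⟩ K₁ Φ₁ hΦ hΦ₁
    haveI : IsCMField K₁ := isCMField_of_cmType_intermediateField K₁ Φ₁
    exact not_exists_exceptional_of_isNondegenerate_inducedCMType hΦ hΦ₁ hA m hm
  · intro h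
    obtain ⟨K₁, Φ₁, hK₁, hΦ, hsep, -⟩ := exists_primitive_inducedCMType_eq_of_isCMField Φ
    haveI := hK₁
    obtain ⟨hN, hC⟩ := normal_and_isMulCommutative_intermediateField (K := K) K₁ inferInstance
    haveI := hN
    haveI := hC
    exact exists_exceptional_of_not_isNondegenerate_inducedCMType hΦ hsep (h K₁ Φ₁ hΦ) hA

/-- **The dichotomy for abelian CM fields**: every abelian variety `A` with complex multiplication by an ABELIAN CM
field `K` (any type `Φ`) either has its whole Hodge ring generated by divisor classes or carries an exceptional class
on `A` itself — never only on a proper power (contrast White's Thm. 1 for a non-abelian `K`).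
[cite: White1993SporadicCycles, §1 and §4 Theorem 3] [cite: Hazama2003CyclicCM, Rem. 4.10] -/
theorem forall_hodgeClassSpan_eq_or_exists_exceptional (hA : IsCMTypeRealisation Φ A ι θ) :
    (∀ m : ℕ, hodgeClassSpan (finrank ℚ K / 2) A.X m = divisorClassesSpan A.X (finrank ℚ K / 2) m) ∨
      ∃ m : ℕ, ∃ c : complexBetti A.X (2 * m), IsRationalClass c ∧
        IsOfHodgeType (finrank ℚ K / 2) A.X (2 * m) m m c ∧ c ∉ divisorClassesSpan A.X (finrank ℚ K / 2) m := by
  obtain ⟨K₁, Φ₁, hK₁, hΦ, hsep, -⟩ := exists_primitive_inducedCMType_eq_of_isCMField Φ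
  haveI := hK₁
  obtain ⟨hN, hC⟩ := normal_and_isMulCommutative_intermediateField (K := K) K₁ inferInstance
  haveI := hN
  haveI := hC
  by_cases hΦ₁ : IsNondegenerate Φ₁
  · exact Or.inl fun m => forall_hodgeClassSpan_eq_of_isNondegenerate_inducedCMType hΦ hΦ₁ hA m
  · exact Or.inr (exists_exceptional_of_not_isNondegenerate_inducedCMType hΦ hsep hΦ₁ hA)

end Intrinsic

end AbelianCMField

end Literature.AlgebraicGeometry.Pohlmann1968

end
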